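import Literature.MathematicalPhysics.QuantumFieldTheory.Sweep1ShenZhuZhuProofs
import Literature.MathematicalPhysics.QuantumFieldTheory.SUNBakryEmeryPoincare
import HarnessLib

/-!
# Discharge of `shenZhuZhu_strongCoupling` (Sweep1, `constructive-qft.S16`)

Sibling proof file of `Literature/MathematicalPhysics/QuantumFieldTheory/Sweep1.lean`: the named
fact `Literature.MathematicalPhysics.QuantumFieldTheory.shenZhuZhu_strongCoupling` (Shen–Zhu–Zhu,
CMP 400 (2023) 805, arXiv:2204.12737, Thm. 1.2, Rem. 1.3 and Cor. "mass gap", in the periodic /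
free-boundary vocabulary of `Sweep1`) holds for every `SU(N)` model `(G, ρ)`.

Proof: `shenZhuZhu_strongCoupling_of_shen_zhu_zhu` (`Sweep1ShenZhuZhuProofs.lean`, the bridge to
the DLR formulation `shen_zhu_zhu`) and `shen_zhu_zhu_holds` (`SUNBakryEmeryPoincare.lean`: the
Dobrushin route `shen_zhu_zhu_of_haarPoincare` plus the Bakry–Émery one-link Poincaré inequality on
`SU(N)` proved from scratch). No definition or named fact is introduced.

## References

* H. Shen, R. Zhu, X. Zhu, *A stochastic analysis approach to lattice Yang–Mills at strong
  coupling*, CMP 400 (2023) 805–851, arXiv:2204.12737: Assumption 1.1, Thm. 1.2, Rem. 1.3,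
  Lemma 4.1, (4.4)–(4.6), Cor. 1.6.
-/

namespace Literature.MathematicalPhysics.QuantumFieldTheory

variable {d N : ℕ} {G : Type*} [Group G] [TopologicalSpace G] [IsTopologicalGroup G]
  [CompactSpace G] [MeasurableSpace G] [BorelSpace G] (ρ : G →* Matrix (Fin N) (Fin N) ℂ)

/-- **Shen–Zhu–Zhu at strong coupling** (CMP 400 (2023), arXiv:2204.12737, Thm. 1.2, Rem. 1.3,
Cor. 1.6; `constructive-qft.S16`): discharge of the named fact `shenZhuZhu_strongCoupling ρ` — for
an `SU(N)` model `(G, ρ)`, `N ≥ 2`, `d ≥ 2` and `|β| < N/(16(d-1))` (bare coupling `β = N β_SZZ`),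
the periodic states converge weakly to a translation-invariant probability measure which is the
unique infinite-volume limit and has exponentially decaying plaquette covariances.
[cite: arXiv220412737, Thm. 1.2, Rem. 1.3, Cor. 1.6] -/
theorem shenZhuZhu_strongCoupling_holds : shenZhuZhu_strongCoupling (d := d) ρ :=
  shenZhuZhu_strongCoupling_of_shen_zhu_zhu ρ (shen_zhu_zhu_holds d N)

end Literature.MathematicalPhysics.QuantumFieldTheory
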